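import Literature.AlgebraicGeometry.Kawanoue2007.WeakOrderMuTilde
import Literature.AlgebraicGeometry.Kawanoue2007.IdealisticFiltrationSaturation
import Literature.AlgebraicGeometry.Kawanoue2007.CoefficientLemma
import Literature.AlgebraicGeometry.Kawanoue2007.NonsingularityPrincipleLevelOne
import Literature.AlgebraicGeometry.Resolution.SmoothImpliesRegular
import Mathlib.RingTheory.Smooth.Basic
import Mathlib.FieldTheory.IsAlgClosed.Basic
import Mathlib.Algebra.CharP.Defs
import HarnessLib

/-!
# Kawanoue 2007, Part I, §4.2: the nonsingularity principle (Theorem 4.2.1.1) — NAMED FACTS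

H. Kawanoue, *Toward resolution of singularities over a field of positive characteristic. Part I. Foundation;
the language of the idealistic filtration*, Publ. RIMS **43** (2007) 819–909 (= arXiv:math/0607009) [Kawanoue2007],
Chapter 4 «Nonsingularity principle», §4.2 (refereed). Read on the held arXiv text (`lit read paper:arxiv-math-0607009`):
chapter setting chunk p0085 L17, Setting 4.1.1 (conditions (i)(ii)) chunk p0086 L1–L6, Setting 4.1.3 (condition (iii),
`ord_ℋ`, `μ_ℋ(𝕀)`) chunk p0090 L31–L47, **Theorem 4.2.1.1** chunk p0094 L7–L22, Remark 4.2.1.2 (1)–(4) chunk p0094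
L24 – p0095 L3. Campaign `res-hironaka` (D-0089), rung LIT-6 (Kawanoue / Kawanoue–Matsuki, the Idealistic Filtration
Program as a refereed COMPARISON programme); typed because the director's critic-side batch ORDER (2026-08-27T14:38:23Z,
paper (6)) asks for the IFP invariant's components AND «what they prove», and the RES-C requirement row (iv) of the F10
«IFP-type» family cites this theorem («smooth max locus by a nonsingularity principle [I Thm 4.2.1.1 / II Thm A.1.1.1]»).
This is a SETTLED-LITERATURE file: two named facts `def … : Prop` with `[cite]`, stated in the tree's Kawanoue
vocabulary (`IdealisticFiltration`, `IsBSaturated`/`IsDSaturated`, `IsWeakLGS`, `muTilde`, `generate`), statements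
only (no proof is claimed; users take `(h : Kawanoue2007_thm_4_2_1_1)`), plus one PROVED edge between them. Nothing of
Hironaka's 2017 manuscript is referred to or asserted.

## The printed statement and how it is typed (faithfulness notes)

* **Setting of Chapter 4** (p0085 L17): «`R` represents the localization at a maximal ideal, or its completion, of the
  coordinate ring of an affine open subset of a variety `W` smooth over an algebraically closed field `k` of
  `char(k) = p > 0`, or characteristic zero where we formally set `p = ∞`». TYPED: `k` an algebraically closed field of
  exponential characteristic `p` (Mathlib `ExpChar k p`: `p` the prime characteristic, or `p = 1` in characteristic
  zero — the tree's rendering of Kawanoue's «`p = ∞`, `∞^0 = 1`» convention, see `LeadingGeneratorSystem.lean`: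
  with `p = 1` every level `p^e` is `1`), `A` a finitely generated smooth `k`-algebra which is a domain («the coordinate
  ring of an affine open subset of a variety `W` smooth over `k`»), `𝔫 ⊂ A` a maximal ideal, `R = A_𝔫`
  (`Localization.AtPrime 𝔫`). The alternative «or its completion» is NOT covered
  (`-- TODO(general form): R = Â_𝔫`).
* **Setting 4.1.1 (i)(ii) + Setting 4.1.3 (iii)** (p0086 L1–L6, p0090 L33–L37): «`ℋ = {h_1, …, h_N} ⊂ R` … nonnegative
  integers `0 ≤ e_1 ≤ ⋯ ≤ e_N` … (i) `h_l ∈ 𝔪^{p^{e_l}}` and `h̄_l = (h_l mod 𝔪^{p^{e_l}+1}) ∈ F^{e_l}(G_1)`; (ii)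
  `{h̄_l^{p^{e_s−e_l}} ; e_l ≤ e_s}` consists of `#{l ; e_l ≤ e_s}`-distinct and `k`-linearly independent elements …
  for `s = 1, …, N`; (iii) `(h_l, p^{e_l}) ∈ 𝕀`». TYPED as the tree's `IsWeakLGS p 𝕀 h e` (Remark 3.1.3.3 (2), the
  class «better suited for … inductional proofs … we refer the reader to Chapter 4», `LeadingGeneratorSystem.lean`) on
  a FINITE index type: its fields are exactly (iii) (`level_mem`), (i) (`pow_mem`, `pure` — membership in
  `L(𝕀)^{pure}_{p^{e_l}}`, which given (iii) and `h_l ∈ 𝔪^{p^{e_l}}` is the printed `h̄_l ∈ F^{e_l}(G_1)`), and (ii) as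
  linear independence of `{h̄_l^{p^{e−e_l}} ; e_l ≤ e}` for EVERY `e ∈ ℤ_{≥0}` (the print asks it for `e = e_s`,
  `s = 1, …, N`; asking it for all `e` is a priori more, so the typed fact is at most WEAKER than the printed one). The
  ordering `e_1 ≤ ⋯ ≤ e_N` is a labelling convention and is not imposed.
* **`μ_ℋ(𝕀) = ∞`** (p0090 L39–L45, p0094 L9): `ord_ℋ(f) = sup{n ; f ∈ 𝔪ⁿ + (ℋ)}`,
  `μ_ℋ(𝕀) = inf{ord_ℋ(f)/a ; (f, a) ∈ 𝕀, a > 0}` — the tree's `muTilde 𝕀 h` (`WeakOrderMuTilde.lean`, literally this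
  formula with `(ℋ) = Ideal.span (range h)`); hypothesis `muTilde 𝕀 h = ⊤`.
* **Conclusion (1)** «`ℍ = {(h_l, p^{e_l}) ; l = 1, …, N}` generates the idealistic filtration `𝕀`, i.e., `𝕀 = G(ℍ)`»:
  `𝕀 = IdealisticFiltration.generate (range (l ↦ (h_l, p^{e_l})))`. **Conclusion (2)** «The elements in `ℍ` are all
  concentrated at level `p^0 = 1`, i.e., `ℍ ⊂ R × {1}`»: `∀ l, p ^ e_l = 1` (for `p` prime this is `e_l = 0`; for the
  characteristic-zero convention `p = 1` it is automatic, as in print where `∞^e = 1` forces `e = 0`). The printed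
  consequence «`Supp(𝕀) = V(ℋ)`, and hence it is nonsingular» is a consequence of (1)(2), recorded here, not typed.
* **Remark 4.2.1.2 (4)** (p0095 L3): «In order to show `𝕀 = G(ℍ)`, we only need `𝕀` to be 𝔇-saturated, while in order
  to show `ℍ ⊂ R × {1}`, we need `𝕀` to be 𝔅-saturated» — typed as the separate fact
  `Kawanoue2007_thm_4_2_1_1_generate` (conclusion (1) under 𝔇-saturation only; it is also Step 1 of the proof of
  Kawanoue–Matsuki 2010, Thm. A.1.1.1: «Show `𝕀_P = G_{R_P}(ℍ)` for any LGS `ℍ` of `𝕀_P` … this part of the proof did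
  not use the assumption that `𝕀_P` is ℜ-saturated», arXiv:math/0612008 chunk p0057 L13–L17), with the PROVED edge
  `Kawanoue2007_thm_4_2_1_1_generate.of_isBSaturated` (a 𝔅-saturated filtration is 𝔇-saturated).

## Update (res-lit-2 g20, 2026-08-27): F-92b DISCHARGED

`Kawanoue2007_thm_4_2_1_1_generate_holds : Kawanoue2007_thm_4_2_1_1_generate` is PROVED below (section `Discharge`), by
the printed argument of p0095 L14–L22: the Coefficient Lemma 4.1.4.1 (`CoefficientLemma.lean`, `coefficientLemma`) with
`μ = N/δ` arbitrary large (`μ_ℋ(𝕀) = ∞`), Krull's intersection theorem (`mem_of_forall_mem_sup_maximalIdeal_pow`), and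
`H^B ∈ 𝕁_{|[B]|}` for every idealistic filtration `𝕁` containing the `(h_l, p^{e_l})`. The instances the Coefficient
Lemma needs for `R = A_𝔫` (regular: `Resolution.isRegularLocalRing_of_isSmoothAt`; essentially of finite type and
formally smooth over `k`; `k` perfect) are derived from the fact's own binders.

## Update (res-lit-2 g20, 2026-08-27, later): F-92 DISCHARGED

`Kawanoue2007_thm_4_2_1_1_holds : Kawanoue2007_thm_4_2_1_1` is PROVED below (section `Discharge`, after the 𝔇-saturated
form): (1) is `Kawanoue2007_thm_4_2_1_1_generate_holds`; (2) «`ℍ ⊂ R × {1}`» is `pow_level_eq_one_atPrime` of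
`NonsingularityPrincipleLevelOne.lean` (the printed proof p0095 L21 – p0097 L27: Step 1 `𝕀_a = (ℋ)` radical, Step 2 the
operators `∂_{x_i^{[j]}}`, `j < p^e`, off `ℋ_0` with Prop. 1.3.1.2's expansion along the Kunz `p`-basis, Step 3 the
leading term `x_{L+1}^{p^e}`). No named fact of this file remains undischarged.

## References

* H. Kawanoue, Publ. RIMS 43 (2007) 819–909 = arXiv:math/0607009: Settings 4.1.1 / 4.1.3, Thm. 4.2.1.1, Rem. 4.2.1.2.
  [Kawanoue2007]
* H. Kawanoue, K. Matsuki, Publ. RIMS 46 (2010) 359–422 = arXiv:math/0612008: Thm. A.1.1.1 and its proof, Step 1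
  (the 𝔇-saturated half). [KawanoueMatsuki2010]
-/

noncomputable section

namespace Literature.AlgebraicGeometry.Kawanoue2007

open IsLocalRing
open scoped ENNReal

universe u

/-- NAMED FACT — **Kawanoue 2007, Theorem 4.2.1.1 (nonsingularity principle)** [chunk p0094 L7–L22]: «Let `𝕀` be an
idealistic filtration which is 𝔅-saturated. Let `ℋ = {h_1, …, h_N} ⊂ R` be a subset of `R`, and let
`0 ≤ e_1 ≤ ⋯ ≤ e_N` be nonnegative integers associated to these elements, satisfying conditions (i), (ii), (iii) as
described in Setting 4.1.3. Suppose `μ_ℋ(𝕀) = ∞`. Then (1) `ℍ = {(h_l, p^{e_l}) ; l = 1, …, N}` generates the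
idealistic filtration `𝕀`, i.e., `𝕀 = G(ℍ)`. (2) The elements in `ℍ` are all concentrated at level `p^0 = 1`, i.e.,
`ℍ ⊂ R × {1}`. … Consequently, … `Supp(𝕀) = V(ℋ)`, and hence … it is nonsingular.» Setting (p0085 L17): `R` = the
localization at a maximal ideal of the coordinate ring of an affine open subset of a variety smooth over an
algebraically closed field `k`, `char k = p > 0` or `0` (`p = ∞`, here `p = 1`). Vendored: for `k` algebraically closed
of exponential characteristic `p`, `A` a smooth finitely generated `k`-domain, `𝔫` a maximal ideal, `R = A_𝔫`, a
𝔅-saturated idealistic filtration `𝕀` over `R`, and a finite family `(h_l, e_l)` with `IsWeakLGS p 𝕀 h e`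
(= conditions (i), (ii) for all levels, (iii)) and `μ_ℋ(𝕀) = ∞` (`muTilde 𝕀 h = ⊤`): `𝕀 = G({(h_l, p^{e_l})})` and
`p^{e_l} = 1` for all `l`. Weaker than the source only in that (ii) is asked at every level and the completion case of
`R` is not covered. DISCHARGED in this file: `Kawanoue2007_thm_4_2_1_1_holds`; users taking
`(h : Kawanoue2007_thm_4_2_1_1)` are fed `_holds`.
-- TODO(general form): `R = Â_𝔫` (completion); the consequence `Supp(𝕀) = V(ℋ)`.
[cite: Kawanoue2007, Thm. 4.2.1.1 (§4.2.1) with Settings 4.1.1 / 4.1.3] -/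
def Kawanoue2007_thm_4_2_1_1 : Prop :=
  ∀ (p : ℕ) (k : Type u) [Field k] [IsAlgClosed k] [ExpChar k p]
    (A : Type u) [CommRing A] [IsDomain A] [Algebra k A] [Algebra.FiniteType k A] [Algebra.Smooth k A]
    (𝔫 : Ideal A) [𝔫.IsMaximal]
    (𝕀 : IdealisticFiltration (Localization.AtPrime 𝔫)),
    IdealisticFiltration.IsBSaturated k 𝕀 →
    ∀ {ι : Type} [Finite ι] (h : ι → Localization.AtPrime 𝔫) (e : ι → ℕ),
      IsWeakLGS p 𝕀 h e → muTilde 𝕀 h = ⊤ →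
        𝕀 = IdealisticFiltration.generate (Set.range fun l => (h l, ((p ^ e l : ℕ) : ℝ))) ∧
        ∀ l, p ^ e l = 1

/-- NAMED FACT — **Kawanoue 2007, Theorem 4.2.1.1 (1) under 𝔇-saturation only** [Rem. 4.2.1.2 (4), chunk p0095 L3:
«In order to show `𝕀 = G(ℍ)`, we only need `𝕀` to be 𝔇-saturated, while in order to show `ℍ ⊂ R × {1}`, we need
`𝕀` to be 𝔅-saturated»; = Kawanoue–Matsuki 2010, proof of Thm. A.1.1.1, Step 1, arXiv:math/0612008 chunk p0057
L13–L17: «we claim `𝕀_P = G_{R_P}(ℍ)` for any LGS `ℍ` of `𝕀_P`. … we can use the same argument as presented in the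
proof of the nonsingularity principle formulated in Chapter 4 of Part I. Note that this part of the proof did not use
the assumption that `𝕀_P` is ℜ-saturated»]. Vendored: same setting as `Kawanoue2007_thm_4_2_1_1` with `𝕀` only
𝔇-saturated (`IsDSaturated k 𝕀`): `IsWeakLGS p 𝕀 h e` and `μ_ℋ(𝕀) = ∞` imply `𝕀 = G({(h_l, p^{e_l})})`.
DISCHARGED in this file: `Kawanoue2007_thm_4_2_1_1_generate_holds` (via the Coefficient Lemma 4.1.4.1,
`CoefficientLemma.lean`); users taking `(h : Kawanoue2007_thm_4_2_1_1_generate)` are fed `_holds`.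
-- TODO(general form): `R = Â_𝔫` (completion).
[cite: Kawanoue2007, Thm. 4.2.1.1 (1) with Rem. 4.2.1.2 (4)] -/
def Kawanoue2007_thm_4_2_1_1_generate : Prop :=
  ∀ (p : ℕ) (k : Type u) [Field k] [IsAlgClosed k] [ExpChar k p]
    (A : Type u) [CommRing A] [IsDomain A] [Algebra k A] [Algebra.FiniteType k A] [Algebra.Smooth k A]
    (𝔫 : Ideal A) [𝔫.IsMaximal]
    (𝕀 : IdealisticFiltration (Localization.AtPrime 𝔫)),
    IdealisticFiltration.IsDSaturated k 𝕀 →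
    ∀ {ι : Type} [Finite ι] (h : ι → Localization.AtPrime 𝔫) (e : ι → ℕ),
      IsWeakLGS p 𝕀 h e → muTilde 𝕀 h = ⊤ →
        𝕀 = IdealisticFiltration.generate (Set.range fun l => (h l, ((p ^ e l : ℕ) : ℝ)))

/-- **PROVED edge**: the 𝔇-saturated form of conclusion (1) gives conclusion (1) of Theorem 4.2.1.1 for a
𝔅-saturated filtration (𝔅-saturated = 𝔇-saturated and ℜ-saturated, Def. 2.1.5.1).
[cite: Kawanoue2007, Thm. 4.2.1.1 (1), Rem. 4.2.1.2 (4), Def. 2.1.5.1] -/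
theorem Kawanoue2007_thm_4_2_1_1_generate.of_isBSaturated (H : Kawanoue2007_thm_4_2_1_1_generate.{u})
    (p : ℕ) (k : Type u) [Field k] [IsAlgClosed k] [ExpChar k p]
    (A : Type u) [CommRing A] [IsDomain A] [Algebra k A] [Algebra.FiniteType k A] [Algebra.Smooth k A]
    (𝔫 : Ideal A) [𝔫.IsMaximal]
    (𝕀 : IdealisticFiltration (Localization.AtPrime 𝔫)) (hB : IdealisticFiltration.IsBSaturated k 𝕀)
    {ι : Type} [Finite ι] (h : ι → Localization.AtPrime 𝔫) (e : ι → ℕ)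
    (hH : IsWeakLGS p 𝕀 h e) (hμ : muTilde 𝕀 h = ⊤) :
    𝕀 = IdealisticFiltration.generate (Set.range fun l => (h l, ((p ^ e l : ℕ) : ℝ))) :=
  H p k A 𝔫 𝕀 hB.1 h e hH hμ

/-- **Consistency of the two vendored forms**: if both facts hold, the conjunction asserted by
`Kawanoue2007_thm_4_2_1_1` has its first component supplied by `Kawanoue2007_thm_4_2_1_1_generate` — i.e. the
𝔅-saturated theorem is «(1) under 𝔇-saturation» plus «(2) under 𝔅-saturation», as Rem. 4.2.1.2 (4) says.
[cite: Kawanoue2007, Rem. 4.2.1.2 (4)] -/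
theorem Kawanoue2007_thm_4_2_1_1.level_one (H : Kawanoue2007_thm_4_2_1_1.{u})
    (p : ℕ) (k : Type u) [Field k] [IsAlgClosed k] [ExpChar k p]
    (A : Type u) [CommRing A] [IsDomain A] [Algebra k A] [Algebra.FiniteType k A] [Algebra.Smooth k A]
    (𝔫 : Ideal A) [𝔫.IsMaximal]
    (𝕀 : IdealisticFiltration (Localization.AtPrime 𝔫)) (hB : IdealisticFiltration.IsBSaturated k 𝕀)
    {ι : Type} [Finite ι] (h : ι → Localization.AtPrime 𝔫) (e : ι → ℕ)
    (hH : IsWeakLGS p 𝕀 h e) (hμ : muTilde 𝕀 h = ⊤) (l : ι) : p ^ e l = 1 :=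
  (H p k A 𝔫 𝕀 hB h e hH hμ).2 l

/-- For `p` prime, conclusion (2) «`ℍ ⊂ R × {1}`» reads `e_l = 0` for every `l` (the levels `p^{e_l}` are all
`p^0 = 1`). [cite: Kawanoue2007, Thm. 4.2.1.1 (2)] -/
theorem Kawanoue2007_thm_4_2_1_1.e_eq_zero (H : Kawanoue2007_thm_4_2_1_1.{u})
    (p : ℕ) [hp : Fact p.Prime] (k : Type u) [Field k] [IsAlgClosed k] [CharP k p]
    (A : Type u) [CommRing A] [IsDomain A] [Algebra k A] [Algebra.FiniteType k A] [Algebra.Smooth k A]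
    (𝔫 : Ideal A) [𝔫.IsMaximal]
    (𝕀 : IdealisticFiltration (Localization.AtPrime 𝔫)) (hB : IdealisticFiltration.IsBSaturated k 𝕀)
    {ι : Type} [Finite ι] (h : ι → Localization.AtPrime 𝔫) (e : ι → ℕ)
    (hH : IsWeakLGS p 𝕀 h e) (hμ : muTilde 𝕀 h = ⊤) (l : ι) : e l = 0 := by
  haveI : ExpChar k p := ExpChar.prime hp.out
  have h1 : p ^ e l = 1 := (H p k A 𝔫 𝕀 hB h e hH hμ).2 l
  exact (Nat.pow_eq_one.mp h1).resolve_left hp.out.one_lt.ne'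

/-! ## Theorem 4.2.1.1 (1): the 𝔇-saturated named fact, discharged -/

section Discharge

/-- Krull's intersection theorem for an ideal of a Noetherian local ring, element form: `x ∈ I + 𝔪^N` for all
`N` implies `x ∈ I` (Matsumura Thm. 8.10 for the module `S/I`). [cite: Matsumura1987, Thm. 8.10] -/
theorem mem_of_forall_mem_sup_maximalIdeal_pow {S : Type*} [CommRing S] [IsLocalRing S] [IsNoetherianRing S]
    {I : Ideal S} {x : S} (hx : ∀ N : ℕ, x ∈ I ⊔ maximalIdeal S ^ N) : x ∈ I := by
  have hinf : (⨅ i : ℕ, maximalIdeal S ^ i • ⊤ : Submodule S (S ⧸ I)) = ⊥ :=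
    Ideal.iInf_pow_smul_eq_bot_of_isLocalRing _ (maximalIdeal.isMaximal S).ne_top
  have hmem : Ideal.Quotient.mk I x ∈ (⨅ i : ℕ, maximalIdeal S ^ i • ⊤ : Submodule S (S ⧸ I)) := by
    rw [Submodule.mem_iInf]
    intro N
    obtain ⟨y, hy, m, hm, hyx⟩ := Submodule.mem_sup.mp (hx N)
    have e1 : Ideal.Quotient.mk I x = m • (1 : S ⧸ I) := by
      rw [← hyx, map_add, Ideal.Quotient.eq_zero_iff_mem.mpr hy, zero_add, Algebra.smul_def, mul_one]
      rfl
    rw [e1]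
    exact Submodule.smul_mem_smul hm Submodule.mem_top
  rw [hinf, Submodule.mem_bot, Ideal.Quotient.eq_zero_iff_mem] at hmem
  exact hmem

/-- **Kawanoue 2007, Theorem 4.2.1.1 (1) under 𝔇-saturation — the named fact `Kawanoue2007_thm_4_2_1_1_generate`
DISCHARGED** [proof of Thm. 4.2.1.1, chunk p0095 L14–L22: «By assumption `R` … is 𝔇-saturated, we may apply
Coefficient Lemma … `μ_ℋ(𝕀) = ∞` … for any `μ` … `𝕀_a ⊂ ∑_{|[B]| ≥ a} R H^B + 𝔪^{⌈μ(a − …)⌉}` … Since `μ` is arbitrary …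
`𝕀_a = ∑_{|[B]| ≥ a} R H^B` … `𝕀 = G(ℍ)`»]: for `R = A_𝔫`, `A` smooth of finite type over `k` algebraically closed of
exponential characteristic `p`, a 𝔇-saturated `𝕀`, and `(h, e)` with `IsWeakLGS p 𝕀 h e` and `μ_ℋ(𝕀) = ∞`, one has
`𝕀 = G({(h_l, p^{e_l})})`. Proof: `coefficientLemma` with `μ = N/δ` (`δ = a − (⌈a⌉ − 1) > 0`) gives
`𝕀_a ⊆ (H^B : |[B]| ≥ a) + 𝔪^N` for every `N`; Krull's intersection theorem; and `H^B ∈ 𝕁_{|[B]|} ⊆ 𝕁_a` for every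
idealistic filtration `𝕁 ∋ (h_l, p^{e_l})`. [cite: Kawanoue2007, Thm. 4.2.1.1 (1) with Rem. 4.2.1.2 (4)] -/
theorem Kawanoue2007_thm_4_2_1_1_generate_holds : Kawanoue2007_thm_4_2_1_1_generate.{u} := by
  intro p k _ _ _ A _ _ _ _ _ 𝔫 _ 𝕀 hD ι _ h e H hμ
  classical
  haveI : IsRegularLocalRing (Localization.AtPrime 𝔫) :=
    Literature.AlgebraicGeometry.Resolution.isRegularLocalRing_of_isSmoothAt k A 𝔫
  haveI : ExpChar (Localization.AtPrime 𝔫) p :=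
    expChar_of_injective_algebraMap (algebraMap k (Localization.AtPrime 𝔫)).injective p
  haveI : Algebra.EssFiniteType A (Localization.AtPrime 𝔫) :=
    Algebra.EssFiniteType.of_isLocalization (Localization.AtPrime 𝔫) 𝔫.primeCompl
  haveI : Algebra.EssFiniteType k (Localization.AtPrime 𝔫) :=
    Algebra.EssFiniteType.comp k A (Localization.AtPrime 𝔫)
  haveI : Algebra.FormallySmooth A (Localization.AtPrime 𝔫) :=
    Algebra.FormallySmooth.of_isLocalization 𝔫.primeCompl
  haveI : Algebra.FormallySmooth k (Localization.AtPrime 𝔫) :=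
    Algebra.FormallySmooth.comp k A (Localization.AtPrime 𝔫)
  haveI : Fintype ι := Fintype.ofFinite ι
  have hp : 0 < p := expChar_pos (Localization.AtPrime 𝔫) p
  refine IdealisticFiltration.Incl.antisymm ?_ (IdealisticFiltration.generate_incl ?_)
  swap
  · rintro _ ⟨l, rfl⟩
    exact (IdealisticFiltration.mem_carrier_iff _ _).mpr (H.level_mem l)
  intro a f hfa
  refine IdealisticFiltration.mem_level_inter_iff.mpr fun 𝕁 h𝕁 => ?_
  have hlevJ : ∀ l, h l ∈ 𝕁.level ((p ^ e l : ℕ) : ℝ) := fun l =>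
    (IdealisticFiltration.mem_carrier_iff _ _).mp (h𝕁 ⟨l, rfl⟩)
  -- `I₀ = (H^B : |[B]| ≥ a) ⊆ 𝕁_a`
  set I₀ : Ideal (Localization.AtPrime 𝔫) :=
    ⨆ (B : ι →₀ ℕ) (_ : a ≤ (bracketDeg p e B : ℝ)), Ideal.span {hPow h B} with hI₀
  have hI₀J : I₀ ≤ 𝕁.level a := iSup₂_le fun B hB => by
    rw [Ideal.span_singleton_le_iff_mem]
    exact 𝕁.mem_of_le hB (hPow_mem_level p h e 𝕁 hlevJ B)
  refine hI₀J (mem_of_forall_mem_sup_maximalIdeal_pow fun N => ?_)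
  rcases le_or_gt a 0 with ha | ha
  · -- `a ≤ 0`: `H^0 = 1 ∈ I₀`
    refine Ideal.mem_sup_left ?_
    have h1 : (1 : Localization.AtPrime 𝔫) ∈ I₀ := by
      refine Ideal.mem_iSup_of_mem 0 (Ideal.mem_iSup_of_mem ?_ ?_)
      · simpa using ha
      · simp
    simpa using I₀.mul_mem_left f h1
  -- `a > 0`: Coefficient Lemma with `μ = N / δ`, `δ = a − (⌈a⌉₊ − 1)`
  set m₀ : ℕ := ⌈a⌉₊ - 1 with hm₀
  have hm₀a : (m₀ : ℝ) < a := by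
    have h1 := Nat.ceil_lt_add_one ha.le
    have h2 : 1 ≤ ⌈a⌉₊ := Nat.one_le_iff_ne_zero.mpr (Nat.pos_iff_ne_zero.mp (Nat.ceil_pos.mpr ha))
    have h3 : ((⌈a⌉₊ - 1 : ℕ) : ℝ) = (⌈a⌉₊ : ℝ) - 1 := by
      rw [Nat.cast_sub h2, Nat.cast_one]
    rw [hm₀, h3]; linarith
  set δ : ℝ := a - m₀ with hδ
  have hδ0 : 0 < δ := by rw [hδ]; linarith
  set μ : ℝ := N / δ with hμdef
  have hμ0 : 0 ≤ μ := div_nonneg (Nat.cast_nonneg N) hδ0.le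
  have hμlt : ENNReal.ofReal μ < muTilde 𝕀 h := by rw [hμ]; exact ENNReal.ofReal_lt_top
  have hCL := coefficientLemma (k := k) p h e 𝕀 hD H hμ0 hμlt a
  rw [hCL] at hfa
  refine (show qIdeal p h e 𝕀 μ a ≤ I₀ ⊔ maximalIdeal (Localization.AtPrime 𝔫) ^ N from
    iSup_le fun B => ?_) hfa
  by_cases hB : a ≤ (bracketDeg p e B : ℝ)
  · have hBI : Ideal.span {hPow h B} ≤ I₀ := by
      rw [hI₀]; exact le_iSup₂_of_le B hB le_rfl
    exact Ideal.mul_le_left.trans (hBI.trans le_sup_left)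
  · refine Ideal.mul_le_right.trans ((levelCut_le_pow 𝕀 μ _).trans ((Ideal.pow_le_pow_right ?_).trans le_sup_right))
    -- `N ≤ ⌈μ (a − |[B]|)⌉₊` since `a − |[B]| ≥ δ`
    rw [not_le] at hB
    have hBm : bracketDeg p e B ≤ m₀ := by
      have : bracketDeg p e B < ⌈a⌉₊ := by
        by_contra hcon
        rw [not_lt] at hcon
        have : (⌈a⌉₊ : ℝ) ≤ bracketDeg p e B := by exact_mod_cast hcon
        linarith [Nat.le_ceil a]
      omega
    have hge : δ ≤ a - bracketDeg p e B := by
      have : (bracketDeg p e B : ℝ) ≤ m₀ := by exact_mod_cast hBm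
      rw [hδ]; linarith
    have hN : (N : ℝ) ≤ μ * (a - bracketDeg p e B) := by
      calc (N : ℝ) = μ * δ := by rw [hμdef, div_mul_cancel₀ _ hδ0.ne']
        _ ≤ μ * (a - bracketDeg p e B) := mul_le_mul_of_nonneg_left hge hμ0
    calc N = ⌈(N : ℝ)⌉₊ := (Nat.ceil_natCast N).symm
      _ ≤ ⌈μ * (a - bracketDeg p e B)⌉₊ := Nat.ceil_mono hN

/-- **Kawanoue 2007, Theorem 4.2.1.1 (the nonsingularity principle, local 𝔅-saturated form) — the named fact
`Kawanoue2007_thm_4_2_1_1` DISCHARGED** [Thm. 4.2.1.1; proof §4.2.2, chunks p0095 L7 – p0097 L27]: (1) `𝕀 = G(ℍ)` by the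
𝔇-saturated form (`Kawanoue2007_thm_4_2_1_1_generate_holds`, the 𝔅-saturation containing the 𝔇-saturation,
Def. 2.1.5.1), (2) `p^{e_l} = 1` by `pow_level_eq_one_atPrime` (`NonsingularityPrincipleLevelOne.lean`).
[cite: Kawanoue2007, Thm. 4.2.1.1] -/
theorem Kawanoue2007_thm_4_2_1_1_holds : Kawanoue2007_thm_4_2_1_1.{u} := by
  intro p k _ _ _ A _ _ _ _ _ 𝔫 _ 𝕀 hB ι _ h e H hμ
  exact ⟨Kawanoue2007_thm_4_2_1_1_generate_holds p k A 𝔫 𝕀 hB.1 h e H hμ,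
    fun l => pow_level_eq_one_atPrime p k A 𝔫 𝕀 hB H hμ l⟩

end Discharge

end Literature.AlgebraicGeometry.Kawanoue2007

end
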